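import Literature.AlgebraicGeometry.Frobenioids.ArithmeticRealificationCor411
import Literature.AlgebraicGeometry.Frobenioids.ArithmeticFrobenioidThm64iiFunctorForm
import HarnessLib

/-!
# Frobenioids I, Theorem 6.4 (ii) AT THE DATA, HYPOTHESIS-FREE: every equivalence `Ψ^rlf : C_{K₁/F₁}^rlf ⥲ C_{K₂/F₂}^rlf`
# of THE realified arithmetic Frobenioids has a degree `deg(Ψ^rlf) ∈ ℝ_{>0}`

Mochizuki, *The geometry of Frobenioids I: the general theory*, Kyushu J. Math. **62** (2008) 293–400, §6,
Theorem 6.4 (ii), kurims text p. 114 ("Let `Ψ^rlf : C₁^rlf ⥲ C₂^rlf` be an equivalence of categories. Then there exists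
an element `deg(Ψ^rlf) ∈ ℝ_{>0}` such that for all Frobenius-trivial `A₁`, `A₂ = Ψ^rlf(A₁)` … the composite of
`δ_{A₂}` with the isomorphism `Pic_Φ(A₁) ⥲ Pic_Φ(A₂)` induced by `Ψ^rlf` … is equal to `deg(Ψ^rlf) · δ_{A₁}`"), proof
p. 115 l. 34 – p. 116 l. 3 ("[cf. assertion (i); Corollary 4.10; Corollary 4.11, (iii)]")
[cite: MochizukiFrdI2008, Thm. 6.4 (ii) p.114].

PROOF-ONLY file (cell abc-iut, layer L1, node `FrdI:Thm6.4(ii)`, sub-DAG `plan/L1/SUBDAG-FrdI-Thm64.md` row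
«T64ii-assembly»; seat abc-iut-L6-t10 gen 4).  The composition of the two halves of the cell's proof of Thm. 6.4
(ii) at THE data (`arithRealification hΦ_i`, seat abc-iut-L1-d2): seat abc-iut-w4-d086's
`ArithFrd.exists_picMap_thm64ii_functor` (`ArithmeticFrobenioidThm64iiFunctorForm.lean`: THE induced `picMap`
satisfies the typed `Thm64ii` GIVEN the Cor. 4.11 (iii) / Cor. 4.10 data `(Ψ^Base, η, Ψ^Φ, hspan)` of `Ψ^rlf` as
binders) with this seat's `arith_rlf_exists_transportData` (`ArithmeticRealificationCor411.lean`: those data EXIST for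
every `Ψ^rlf`, Cor. 4.11 (iii)/(iv) and Cor. 4.10 at the realifications).  Results: **`ArithFrd.thm64ii_arith'`** —
for EVERY equivalence `Ψ^rlf`, THE Cor. 4.11 data OF `Ψ^rlf` (`Ψ^Base` with its `1`-unique base square
`OneUniqueSquare Ψ^rlf Base₁ Base₂ Ψ^Base`, `η`, and `E = Ψ^Φ` pinned by the Div formula `Div(Ψ^rlf φ) = η_A^* E(Div φ)`
on ALL arrows) and THE induced `picMap` (`picMap_A [x] = (η_A)^*[E x]`) satisfy `Thm64ii (arithRealification hΦ₁)
(arithRealification hΦ₂) Ψ^rlf picMap`: ONE `deg(Ψ^rlf) > 0` with `δ_{Ψ A} ∘ picMap_A = deg · δ_A` at every Frobenius-trivial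
`A` — no binder left.  The bare shape `∃ picMap, Thm64ii …` (`ArithFrd.thm64ii_arith`) is recorded too, WITH the
caveat (seat abc-iut-f-016's `ArithFrd.exists_picMap_thm64ii_of_any`, `ArithmeticFrobenioidsThm64SchemaAtData.lean`)
that it is content-free on its own: the content of Thm. 6.4 (ii) is carried by the clauses tying `picMap` to `Ψ^rlf`.
No definitions; nothing of the paper is restated or strengthened; nothing here bears on [IUTchIII] Cor. 3.12.
-/

noncomputable section

namespace Literature.AlgebraicGeometry.Frobenioids

open CategoryTheory Opposite

namespace ArithFrd

variable {F₁ : Type} [Field F₁] [NumberField F₁] {K₁ : Type} [Field K₁] [Algebra F₁ K₁] [IsGalois F₁ K₁]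
  {F₂ : Type} [Field F₂] [NumberField F₂] {K₂ : Type} [Field K₂] [Algebra F₂ K₂] [IsGalois F₂ K₂]
  (hΦ₁ : PreFrobenioid.IsPerfFactorialOn (arithDivisorFunctor F₁ K₁))
  (hΦ₂ : PreFrobenioid.IsPerfFactorialOn (arithDivisorFunctor F₂ K₂))
  (Ψ : PreFrobenioid.rlf (ModelFrobenioid.toElem (arithDivisorFunctor F₁ K₁) (unitsFunctor F₁ K₁) (divNatTrans F₁ K₁)) hΦ₁ ≌
    PreFrobenioid.rlf (ModelFrobenioid.toElem (arithDivisorFunctor F₂ K₂) (unitsFunctor F₂ K₂) (divNatTrans F₂ K₂)) hΦ₂)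

/-- **[FrdI] Theorem 6.4 (ii) at THE data, hypothesis-free — the CONTENTFUL form**: for every equivalence
`Ψ^rlf : C_{K₁/F₁}^rlf ⥲ C_{K₂/F₂}^rlf` there are THE Cor. 4.11 data OF `Ψ^rlf` — `Ψ^Base` (an equivalence, with the
`1`-unique base square `OneUniqueSquare Ψ^rlf Base₁ Base₂ Ψ^Base`), `η : Base₂ ∘ Ψ^rlf ≅ Ψ^Base ∘ Base₁`, `E = Ψ^Φ :
Φ₁^rlf ⥲ Φ₂^rlf` over `Ψ^Base` pinned to `Ψ^rlf` by `Div(Ψ^rlf φ) = η_A^* E(Div φ)` on ALL arrows (Cor. 4.11 (iii)/(iv),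
Cor. 4.10 at the realifications: `arith_rlf_exists_transportData`) — and THE induced `picMap_A : Pic_Φ(A) ⥲ Pic_Φ(Ψ^rlf A)`,
`[x] ↦ (η_A)^*[E x]` ("the isomorphism … induced by `Ψ^rlf`"), satisfying the typed `Thm64ii` for THE
`ArithRealification`s (seat abc-iut-w4-d086's `ArithFrd.exists_picMap_thm64ii_functor`): ONE `deg(Ψ^rlf) ∈ ℝ_{>0}`
with `δ_{Ψ A} ∘ picMap_A = deg · δ_A` for every Frobenius-trivial `A`; the last two conjuncts record `δ_{Ψ A}` of
`picMap_A [x]` as the degree of `[E x]` at `Ψ^Base(Base A)` (the form Thm. 6.4 (iii)/(iv) readers use) and the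
compatibility of `E` with the real spans `ℝ · Φ_i^birat` (Cor. 4.10). [cite: MochizukiFrdI2008, Thm. 6.4 (ii) p.114] -/
theorem thm64ii_arith' :
    ∃ (ΨBase : FinSubextCat F₁ K₁ ⥤ FinSubextCat F₂ K₂) (_ : ΨBase.IsEquivalence)
      (η : Ψ.functor ⋙ (FrdI.Cor54Sub.rlfData (ModelFrobenioid.toElem (arithDivisorFunctor F₂ K₂) (unitsFunctor F₂ K₂)
          (divNatTrans F₂ K₂)) hΦ₂).base ≅
        (FrdI.Cor54Sub.rlfData (ModelFrobenioid.toElem (arithDivisorFunctor F₁ K₁) (unitsFunctor F₁ K₁)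
          (divNatTrans F₁ K₁)) hΦ₁).base ⋙ ΨBase)
      (E : PreFrobenioidData.DivisorMonoidIsoOverBase
        (FrdI.Cor54Sub.rlfData (ModelFrobenioid.toElem (arithDivisorFunctor F₁ K₁) (unitsFunctor F₁ K₁)
          (divNatTrans F₁ K₁)) hΦ₁)
        (FrdI.Cor54Sub.rlfData (ModelFrobenioid.toElem (arithDivisorFunctor F₂ K₂) (unitsFunctor F₂ K₂)
          (divNatTrans F₂ K₂)) hΦ₂) ΨBase)
      (picMap : ∀ A, (arithRealification hΦ₁).Pic A ≃+ (arithRealification hΦ₂).Pic (Ψ.functor.obj A)),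
      PreFrobenioidData.OneUniqueSquare Ψ.functor
          (FrdI.Cor54Sub.rlfData (ModelFrobenioid.toElem (arithDivisorFunctor F₁ K₁) (unitsFunctor F₁ K₁)
            (divNatTrans F₁ K₁)) hΦ₁).base
          (FrdI.Cor54Sub.rlfData (ModelFrobenioid.toElem (arithDivisorFunctor F₂ K₂) (unitsFunctor F₂ K₂)
            (divNatTrans F₂ K₂)) hΦ₂).base ΨBase ∧
      (∀ ⦃A B : PreFrobenioid.rlf (ModelFrobenioid.toElem (arithDivisorFunctor F₁ K₁) (unitsFunctor F₁ K₁)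
          (divNatTrans F₁ K₁)) hΦ₁⦄ (φ : A ⟶ B),
        PreFrobenioid.Div (PreFrobenioid.rlfToElem (ModelFrobenioid.toElem (arithDivisorFunctor F₂ K₂)
            (unitsFunctor F₂ K₂) (divNatTrans F₂ K₂)) hΦ₂) (Ψ.functor.map φ) =
          pull _ (η.hom.app A)
            (E.iso (PreFrobenioid.baseObj (PreFrobenioid.rlfToElem (ModelFrobenioid.toElem
              (arithDivisorFunctor F₁ K₁) (unitsFunctor F₁ K₁) (divNatTrans F₁ K₁)) hΦ₁) A)
              (PreFrobenioid.Div (PreFrobenioid.rlfToElem (ModelFrobenioid.toElem (arithDivisorFunctor F₁ K₁)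
                (unitsFunctor F₁ K₁) (divNatTrans F₁ K₁)) hΦ₁) φ))) ∧
      Thm64ii (arithRealification hΦ₁) (arithRealification hΦ₂) Ψ picMap ∧
      (∀ (A : PreFrobenioid.rlf (ModelFrobenioid.toElem (arithDivisorFunctor F₁ K₁) (unitsFunctor F₁ K₁)
          (divNatTrans F₁ K₁)) hΦ₁)
        (x : (RealificationData.canonical (arithDivisorFunctor F₁ K₁) (PreFrobenioid.IsPerfFactorialOn.op hΦ₁)).rlf.obj
          (op A.base)),
        picMap A (Additive.ofMul (QuotientGroup.mk' _ (Algebra.GrothendieckGroup.of x))) =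
          Additive.ofMul (((RealificationData.canonical (arithDivisorFunctor F₂ K₂)
            (PreFrobenioid.IsPerfFactorialOn.op hΦ₂)).realSpan (PreFrobenioid.biratSubfunctor
              (ModelFrobenioid.toElem (arithDivisorFunctor F₂ K₂) (unitsFunctor F₂ K₂) (divNatTrans F₂ K₂)))).picPull
            (X := (Ψ.functor.obj A).base) (Y := ΨBase.obj A.base) (η.hom.app A)
            (QuotientGroup.mk' _ (Algebra.GrothendieckGroup.of (E.iso A.base x))))) ∧
      (∀ (A : PreFrobenioid.rlf (ModelFrobenioid.toElem (arithDivisorFunctor F₁ K₁) (unitsFunctor F₁ K₁)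
          (divNatTrans F₁ K₁)) hΦ₁) (hA' : (arithRealification hΦ₂).ops.IsFrobeniusTrivial (Ψ.functor.obj A))
          (x : (RealificationData.canonical (arithDivisorFunctor F₁ K₁) (PreFrobenioid.IsPerfFactorialOn.op hΦ₁)).rlf.obj
            (op A.base)),
        (arithRealification hΦ₂).δ (Ψ.functor.obj A) hA'
            (picMap A (Additive.ofMul (QuotientGroup.mk' _ (Algebra.GrothendieckGroup.of x)))) =
          Multiplicative.toAdd (ArithRlfPic.picDegree hΦ₂ (ΨBase.obj A.base)
            (QuotientGroup.mk' _ (Algebra.GrothendieckGroup.of (E.iso A.base x))))) ∧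
      (∀ X : FinSubextCat F₁ K₁,
        (((RealificationData.canonical (arithDivisorFunctor F₁ K₁) (PreFrobenioid.IsPerfFactorialOn.op hΦ₁)).realSpan
              (PreFrobenioid.biratSubfunctor (ModelFrobenioid.toElem (arithDivisorFunctor F₁ K₁) (unitsFunctor F₁ K₁)
                (divNatTrans F₁ K₁)))).carrier X).map (MonGp.map (E.iso X).toMonoidHom) =
          ((RealificationData.canonical (arithDivisorFunctor F₂ K₂) (PreFrobenioid.IsPerfFactorialOn.op hΦ₂)).realSpan
              (PreFrobenioid.biratSubfunctor (ModelFrobenioid.toElem (arithDivisorFunctor F₂ K₂) (unitsFunctor F₂ K₂)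
                (divNatTrans F₂ K₂)))).carrier (ΨBase.obj X)) := by
  obtain ⟨ΨBase, E, η, hsq, hdiv, hspan⟩ := arith_rlf_exists_transportData F₁ K₁ F₂ K₂ hΦ₁ hΦ₂ Ψ
  haveI : ΨBase.IsEquivalence := hsq.1
  obtain ⟨picMap, h, hval, hδ⟩ := exists_picMap_thm64ii_functor hΦ₁ hΦ₂ Ψ ΨBase η E hspan
  exact ⟨ΨBase, hsq.1, η, E, picMap, hsq, hdiv, h, hval, hδ, hspan⟩

/-- **[FrdI] Theorem 6.4 (ii) at THE data — the schema letter's bare shape**, `∃ picMap, Thm64ii …`, for EVERY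
equivalence `Ψ^rlf` (the `picMap` being THE induced one of `thm64ii_arith'`).  CAVEAT (seat abc-iut-f-016's
`ArithFrd.exists_picMap_thm64ii_of_any`): at THE data this bare shape is content-free by itself, since every `δ_A` is an
isomorphism; the printed content is carried by `thm64ii_arith'`, whose clauses tie `picMap` to `Ψ^rlf`.
[cite: MochizukiFrdI2008, Thm. 6.4 (ii) p.114] -/
theorem thm64ii_arith :
    ∃ picMap : ∀ A, (arithRealification hΦ₁).Pic A ≃+ (arithRealification hΦ₂).Pic (Ψ.functor.obj A),
      Thm64ii (arithRealification hΦ₁) (arithRealification hΦ₂) Ψ picMap := by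
  obtain ⟨-, -, -, -, picMap, -, -, h, -, -, -⟩ := thm64ii_arith' hΦ₁ hΦ₂ Ψ
  exact ⟨picMap, h⟩

end ArithFrd

end Literature.AlgebraicGeometry.Frobenioids

end
-- enqueue re-land 2026-08-26T10:21:25Z (abc-iut-L1-d1 g4, TREE-HEALTH self-remedy; author abc-iut-L6-t10 g4, bytes untouched): comment-only, declarations byte-identical to p433994; purpose = re-dispatch the stranded olean build (module unbuilt > 70 min after ACCEPT; both parents built)

-- build-queue re-enqueue (comment-only re-land by abc-iut-w4-d014 g7, 2026-08-26T10:4xZ): declarations byte-identical to the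
-- accepted tree copy (sha16 be833475cd6720f6); purpose: produce the missing olean (stranded accept) so that PENDING children deferred «no-olean» can verify.
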